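import Summits.QuantumFields.YangMills.Theorems.AlphaInputsT3ACv3AdaptedClassX
import Summits.QuantumFields.YangMills.Theorems.AlphaInputsT3ACv3Reg68LevelsOfFineRegular
import Summits.QuantumFields.YangMills.Theorems.AlphaInputsT3ACv3RegionalThm1Carrier
import Literature.MathematicalPhysics.QuantumFieldTheory.Balaban1983to89.B10Eq71TorusOverlap
import HarnessLib

/-!
# `AlphaInputsT3ACv3OmegaCollarGeometry` — THE REGIONS `Ω_j(h)` OF A LARGE-FIELD HISTORY ARE UNIONS OF BLOCKS WITH COLLARS, IN THE LETTERS THE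
# CONSUMERS READ: LQB's `IsBlockUnion (L^{j′})`, the one-block neighbourhood «a block next to `Ω_{i+1}` lies in `Ω_i`», the blocks under a bond
# ON `Ω_{i+1}` ([Balaban1985Variational] (1) p. 277), and the block of a free corner of an outward straddler of `∂Ω_{i+1}` ((7) p. 278)

Cell `ym3-torus` (HUMAN RULING D-0037, rung R3 — finite-torus SU(2) YM₃, NOT Clay), seat `ym-ust-19936-w4` (gen 6), WIDTH helper on stmt-QuantumFields-19936
`HistoryTailL`; LEAD RULING L-R7 (3) row (G-geo) «`Carriers.Omega` IS A UNION OF BIG BLOCKS WITH COLLARS».  `--supports stmt-QuantumFields-19936 --as helper`;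
def-free; count-neutral; generic `Params` (no T³ letters).

WHAT WAS ALREADY IN THE TREE (imported, not restated).  Block saturation «`Ω_j(h)` is a union of blocks of every level `≤ j`» =
`AdaptedClassX.mem_Omega_iff_of_coarsen_eq` (+ `mem_lam42_iff_of_coarsen_eq`, `coarsen_eq_of_coarsen_eq`); the collar (39) `Reg68LevelsOfFineRegular.collar_of_mem_Omega`
(`y ∈ Ω_j`, `x ∉ Ω_{j−1}` ⇒ `Rcol(j−1) < sdist (j−1) x y`) and its fine-`ℓ¹` hull form `mem_Omega_pred_of_tdist_le`; nesting `AdmissibleRegions.Omega_antitone`; the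
dictionary `coarsen_toFine`, `CollarCount.tdist_le_blockOf`, LQB's `B10Eq71TorusOverlap.cubeIdx_eq_blockIter`.

WHAT THIS FILE ADDS (0 hits before).
* §1 LQB's LETTER: `coarsen_eq_blockIter` (the lane's `Carriers.coarsen` IS pub-balaban's `B14.Eq22Determines.blockIter`), `coarsen_eq_of_cubeIdx_eq` ∕
  `cubeIdx_eq_of_coarsen_eq`, ★ `isBlockUnion_pow_Omega : IsBlockUnion (P.L ^ j′) (Omega M₁ Rcol k h j)` (`j′ ≤ j ≤ k`) — the displayed hypothesis shape of LQB's
  `inSpace6_gaugeAct` ∕ `plaqSmallOn_qsstarGIter_of_isBlockUnion` —, `isBlockUnion_pow_lam42`, `isBlockUnion_pow_sdiff_Omega`.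
* §2 THE ONE-BLOCK NEIGHBOURHOOD IN BLOCK LETTERS: `mem_Omega_of_sdist_le` (contrapositive collar), ★★ `mem_Omega_of_coarsen_near` («every fine site under a
  level-`(i+1)` block within `n` steps of a block of `Ω_{i+1}` lies in `Ω_i`», collar row `L·n + d(L−1) ≤ Rcol i` displayed raw), `toFine_mem_Omega_of_near`,
  `mem_Omega_of_le_of_coarsen_near` (hence in every `Ω_{i′}`, `i′ ≤ i`).
* §3 (G1-geo) ★★ `mem_Omega_of_mem_bondsOn` («the blocks under BOTH end-points of a bond ON `Ω_{i+1}` — print's convention (1) p. 277, `RegionalVP.bondsOn` — lie in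
  `Ω_i`», row `L + d(L−1) ≤ Rcol i`), `mem_Omega_of_le_of_mem_bondsOn`; the proviso of memo #48 (G1) «same `(i+1)`-datum ⇒ same `k`-datum».
* §4 (G2-geo) `tdist_corner_le_two` ∕ `tdist_coarsen_le_two_of_mem_cornerSet` (corner sites of a plaquette are within `ℓ¹`-distance `2`),
  ★★ `mem_sdiff_Omega_of_coarsen_eq_corner` («at an OUTWARD straddler of `∂Ω_{i+1}` — a corner in `Ω_{i+1}`, a corner outside — the whole `(i+1)`-block of the free
  corner lies in `Ω_i ∖ Ω_{i+1}`», row `2L + d(L−1) ≤ Rcol i`), ★ `mem_bondsOn_sdiff_of_blockOf_eq_corner` (the level-`i` bonds read there by a one-step average —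
  `Averaging.local_dep`'s letter `blockOf b′.src = c₊∕c₋` — lie in `bondsOn i (Ω_i ∖ Ω_{i+1})`), `mem_bondsOn_lam42_of_blockOf_eq_corner` (`lam42` wrapper); the
  geometry of memo #48 (G2) «junk-freeness of (7) on `U`'s own datum».
At the T³ record both collar rows are `≤ 5L − 3 ≤ 6M₁ ≤ Rcol j` (`Reg68LevelsOfFineRegular.six_mul_M₁_le_rcolOf`, record size `7L + 3 ≤ M₁`); they are displayed raw here so the
file stays generic.

HONEST FRAMING.  Lattice combinatorics over the lane's own definitions (`Carriers.Regions`); nothing of Bałaban's is asserted; the stub `stub_laneRecordsV4Chi`, the crux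
`HistoryTailL`, B1 and NODE O d = 3 are NOT claimed; YM₃ on T³ = rung R3 — not d = 4, not infinite volume, no mass gap, not Clay.

References: T. Bałaban, CMP 102 (1985) 255–275 [Balaban1985UV3] ((38)–(39) p.266, p.268); CMP 102 (1985) 277–309 [Balaban1985Variational] ((1) p.277, (7) p.278);
CMP 109 (1987) 249–301 [Balaban1987RG1] ((0.1)–(0.3) pp.251–252).
-/

set_option autoImplicit false

namespace Summit.QuantumFields.YangMills.Theorems.OmegaCollarGeometry

open Literature.MathematicalPhysics.QuantumFieldTheory.Balaban1983to89
open Literature.MathematicalPhysics.QuantumFieldTheory.Balaban1983to89.B10Eq38TorusDomains (toFine toFine_zero toFine_succ cornerSet IsBlockUnion tdist_self)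
open Literature.MathematicalPhysics.QuantumFieldTheory.Balaban1983to89.B10Eq42TorusConstraint (lam42 lam42_of_lt)
open Literature.MathematicalPhysics.QuantumFieldTheory.Balaban1983to89.B3Ineq314Cubes (cubeIdx)
open Literature.MathematicalPhysics.QuantumFieldTheory.Balaban1983to89.B14.Eq22Determines (blockIter blockIter_zero blockIter_succ)
open Literature.MathematicalPhysics.QuantumFieldTheory.Balaban1983to89.B10Eq71TorusOverlap (cubeIdx_eq_blockIter)
open Literature.MathematicalPhysics.QuantumFieldTheory.Balaban1983to89.B3Taylor310LocalRemainder (tdist_comm tdist_triangle)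
open Summit.QuantumFields.Balaban3D.Carriers
open Summit.QuantumFields.Balaban3D.Proofs.AdmissibleRegions (Omega_antitone)
open Summit.QuantumFields.Balaban3D.Proofs.CollarCount (tdist_le_blockOf)
open Summit.QuantumFields.Balaban3D.Proofs.Run3Collar (tdist_shift_le)
open Summit.QuantumFields.YangMills.Theorems (coarsen_toFine coarsen_eq_of_coarsen_eq mem_Omega_iff_of_coarsen_eq mem_lam42_iff_of_coarsen_eq)
open Summit.QuantumFields.YangMills.Theorems.Reg68LevelsOfFineRegular (collar_of_mem_Omega)
open Summit.QuantumFields.YangMills.Theorems.RegionalVP (bondsOn mem_bondsOn_iff)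

variable {P : Params}

/-! ## §1 LQB's letter: `coarsen = blockIter`, and `Ω_j(h)` is an `IsBlockUnion (L^{j′})` for every `j′ ≤ j` -/

section BlockUnion

/-- **THE LANE'S AND LQB'S ITERATED BLOCK MAPS AGREE**: `Carriers.coarsen j = B14.Eq22Determines.blockIter j` (both iterate `Setup.blockOf` from the fine torus).
[cite: Balaban1987RG1, (0.1) p.251] -/
theorem coarsen_eq_blockIter : ∀ (j : ℕ) (x : Site P 0), coarsen j x = blockIter j x
  | 0, _ => rfl
  | j + 1, x => by rw [coarsen_succ, blockIter_succ, coarsen_eq_blockIter j x]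

/-- Equal `L^j`-cube labels give equal `j`-blocks (standing range `j ≤ m + K`). [cite: Balaban1987RG1, (0.1) p.252] -/
theorem coarsen_eq_of_cubeIdx_eq {j : ℕ} (hj : j ≤ P.m + P.K) {x y : Site P 0} (h : cubeIdx (P.L ^ j) x = cubeIdx (P.L ^ j) y) :
    coarsen j x = coarsen j y := by
  rw [cubeIdx_eq_blockIter hj, cubeIdx_eq_blockIter hj] at h
  rw [coarsen_eq_blockIter, coarsen_eq_blockIter]
  funext μ
  exact ZMod.val_injective _ (congrFun h μ)

/-- Equal `j`-blocks give equal `L^j`-cube labels (standing range). [cite: Balaban1987RG1, (0.1) p.252] -/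
theorem cubeIdx_eq_of_coarsen_eq {j : ℕ} (hj : j ≤ P.m + P.K) {x y : Site P 0} (h : coarsen j x = coarsen j y) :
    cubeIdx (P.L ^ j) x = cubeIdx (P.L ^ j) y := by
  rw [cubeIdx_eq_blockIter hj, cubeIdx_eq_blockIter hj, ← coarsen_eq_blockIter, ← coarsen_eq_blockIter, h]

variable (M₁ : ℕ) (Rcol : ℕ → ℕ)

/-- **★ «Ω_j IS A UNION OF BLOCKS» IN LQB's LETTER**: `Ω_j(h)` is an `IsBlockUnion (L^{j′})` (membership depends only on the `L^{j′}`-cube label) for every `j′ ≤ j ≤ k`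
in the standing range — the displayed hypothesis shape of LQB's `B10Eq68TorusRegularity.inSpace6_gaugeAct` ∕ `B15Prop1DatumSmall7AtZSequence.plaqSmallOn_qsstarGIter_of_isBlockUnion`.
[cite: Balaban1985UV3, (39) p.266] -/
theorem isBlockUnion_pow_Omega {k : ℕ} (h : Hist P k) {j j' : ℕ} (hj' : j' ≤ j) (hjk : j ≤ k) (hr : j' ≤ P.m + P.K) :
    IsBlockUnion (P.L ^ j') (Omega M₁ Rcol k h j) :=
  fun _ _ hxy => mem_Omega_iff_of_coarsen_eq M₁ Rcol h hj' hjk (coarsen_eq_of_cubeIdx_eq hr hxy)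

/-- The read regions `lam42 Ω(h) k i` (`Λ_i = Ω_i ∖ Ω_{i+1}` below the top, `Ω_k` at the top) are `IsBlockUnion (L^{j′})` for `j′ ≤ i ≤ k`.
[cite: Balaban1985UV3, (40)–(42) p.266] -/
theorem isBlockUnion_pow_lam42 {k : ℕ} (h : Hist P k) {i j' : ℕ} (hj' : j' ≤ i) (hik : i ≤ k) (hr : j' ≤ P.m + P.K) :
    IsBlockUnion (P.L ^ j') (lam42 (Omega M₁ Rcol k h) k i) :=
  fun _ _ hxy => mem_lam42_iff_of_coarsen_eq M₁ Rcol h hj' hik (coarsen_eq_of_cubeIdx_eq hr hxy)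

/-- The rings `Ω_i ∖ Ω_{i+1}` are `IsBlockUnion (L^{j′})` for `j′ ≤ i`, `i + 1 ≤ k`. [cite: Balaban1985UV3, p.266] -/
theorem isBlockUnion_pow_sdiff_Omega {k : ℕ} (h : Hist P k) {i j' : ℕ} (hj' : j' ≤ i) (hik : i + 1 ≤ k) (hr : j' ≤ P.m + P.K) :
    IsBlockUnion (P.L ^ j') (Omega M₁ Rcol k h i \ Omega M₁ Rcol k h (i + 1)) :=
  (isBlockUnion_pow_Omega M₁ Rcol h hj' (Nat.le_of_succ_le hik) hr).diff (isBlockUnion_pow_Omega M₁ Rcol h (hj'.trans (Nat.le_succ i)) hik hr)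

end BlockUnion

/-! ## §2 The one-block neighbourhood of `Ω_{i+1}` lies in `Ω_i`, in block letters -/

section Collar

variable (M₁ : ℕ) (Rcol : ℕ → ℕ)

/-- **THE COLLAR, CONTRAPOSITIVE FORM**: a fine site at scale-`i` distance `≤ Rcol i` from a site of `Ω_{i+1}(h)` lies in `Ω_i(h)` (`i + 1 ≤ k`).
[cite: Balaban1985UV3, (39) p.266] -/
theorem mem_Omega_of_sdist_le {k : ℕ} (h : Hist P k) {i : ℕ} (hik : i + 1 ≤ k) {x y : Site P 0} (hy : y ∈ Omega M₁ Rcol k h (i + 1))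
    (hd : sdist i x y ≤ Rcol i) : x ∈ Omega M₁ Rcol k h i := by
  by_contra hx
  have hc := collar_of_mem_Omega M₁ Rcol k h (i + 1) (Nat.succ_pos i) hik hy (x := x) (by simpa using hx)
  simp only [Nat.add_sub_cancel] at hc
  exact absurd hc (not_lt.mpr hd)

/-- **★★ THE ONE-BLOCK NEIGHBOURHOOD IN BLOCK LETTERS**: if the base point of the level-`(i+1)` site `z` lies in `Ω_{i+1}(h)` and `z′` is within `n` lattice steps of `z`,
then EVERY fine site of the `(i+1)`-block of `z′` lies in `Ω_i(h)` — under the collar row `L·n + d(L−1) ≤ Rcol i` (expansion `CollarCount.tdist_le_blockOf` + the collar).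
[cite: Balaban1985UV3, (39) p.266] -/
theorem mem_Omega_of_coarsen_near {k : ℕ} (h : Hist P k) {i : ℕ} (hik : i + 1 ≤ k) (hr : i + 1 ≤ P.m + P.K) {n : ℕ}
    (hR : P.L * n + P.d * (P.L - 1) ≤ Rcol i) {z z' : Site P (i + 1)} (hz : toFine (i + 1) z ∈ Omega M₁ Rcol k h (i + 1))
    (hzz' : Site.tdist z' z ≤ n) {x : Site P 0} (hx : coarsen (i + 1) x = z') : x ∈ Omega M₁ Rcol k h i := by
  refine mem_Omega_of_sdist_le M₁ Rcol h hik hz ?_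
  have hb1 : blockOf (coarsen i x) = z' := hx
  have hb2 : blockOf (coarsen i (toFine (i + 1) z)) = z := coarsen_toFine (i + 1) hr z
  show Site.tdist (coarsen i x) (coarsen i (toFine (i + 1) z)) ≤ Rcol i
  calc Site.tdist (coarsen i x) (coarsen i (toFine (i + 1) z))
      ≤ P.L * Site.tdist (blockOf (coarsen i x)) (blockOf (coarsen i (toFine (i + 1) z))) + P.d * (P.L - 1) := tdist_le_blockOf hr _ _
    _ = P.L * Site.tdist z' z + P.d * (P.L - 1) := by rw [hb1, hb2]
    _ ≤ P.L * n + P.d * (P.L - 1) := Nat.add_le_add_right (Nat.mul_le_mul_left _ hzz') _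
    _ ≤ Rcol i := hR

/-- The base-point form: a level-`(i+1)` site within `n` steps of a site based in `Ω_{i+1}(h)` is based in `Ω_i(h)` (row `L·n + d(L−1) ≤ Rcol i`).
[cite: Balaban1985UV3, (39) p.266] -/
theorem toFine_mem_Omega_of_near {k : ℕ} (h : Hist P k) {i : ℕ} (hik : i + 1 ≤ k) (hr : i + 1 ≤ P.m + P.K) {n : ℕ}
    (hR : P.L * n + P.d * (P.L - 1) ≤ Rcol i) {z z' : Site P (i + 1)} (hz : toFine (i + 1) z ∈ Omega M₁ Rcol k h (i + 1))
    (hzz' : Site.tdist z' z ≤ n) : toFine (i + 1) z' ∈ Omega M₁ Rcol k h i :=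
  mem_Omega_of_coarsen_near M₁ Rcol h hik hr hR hz hzz' (coarsen_toFine (i + 1) hr z')

/-- … hence in every `Ω_{i′}(h)`, `i′ ≤ i` (nesting (38), `AdmissibleRegions.Omega_antitone`). [cite: Balaban1985UV3, (38)–(39) p.266] -/
theorem mem_Omega_of_le_of_coarsen_near {k : ℕ} (h : Hist P k) {i : ℕ} (hik : i + 1 ≤ k) (hr : i + 1 ≤ P.m + P.K) {n : ℕ}
    (hR : P.L * n + P.d * (P.L - 1) ≤ Rcol i) {z z' : Site P (i + 1)} (hz : toFine (i + 1) z ∈ Omega M₁ Rcol k h (i + 1))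
    (hzz' : Site.tdist z' z ≤ n) {x : Site P 0} (hx : coarsen (i + 1) x = z') {i' : ℕ} (hi' : i' ≤ i) : x ∈ Omega M₁ Rcol k h i' :=
  Omega_antitone M₁ Rcol k h i' i hi' (Nat.le_of_succ_le hik) (mem_Omega_of_coarsen_near M₁ Rcol h hik hr hR hz hzz' hx)

end Collar

/-! ## §3 (G1-geo) The blocks under both end-points of a bond ON `Ω_{i+1}` lie in `Ω_i` -/

section Bonds

variable (M₁ : ℕ) (Rcol : ℕ → ℕ)

/-- **★★ (G1-geo)**: for a level-`(i+1)` bond `c` ON `Ω_{i+1}(h)` (print's convention (1) p. 277: an end-point based in the region, `RegionalVP.bondsOn`), every fine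
site of the `(i+1)`-blocks of BOTH end-points lies in `Ω_i(h)` — under the collar row `L + d(L−1) ≤ Rcol i`.  (The end-point inside contributes its own block by
saturation and nesting; the other end-point is one step away.) [cite: Balaban1985Variational, (1) p.277; Balaban1985UV3, (39) p.266] -/
theorem mem_Omega_of_mem_bondsOn {k : ℕ} (h : Hist P k) {i : ℕ} (hik : i + 1 ≤ k) (hr : i + 1 ≤ P.m + P.K)
    (hR : P.L + P.d * (P.L - 1) ≤ Rcol i) {c : PBond P (i + 1)} (hc : c ∈ bondsOn (i + 1) (Omega M₁ Rcol k h (i + 1)))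
    {x : Site P 0} (hx : coarsen (i + 1) x = c.src ∨ coarsen (i + 1) x = c.tgt) : x ∈ Omega M₁ Rcol k h i := by
  have hR' : P.L * 1 + P.d * (P.L - 1) ≤ Rcol i := by simpa using hR
  have h01 : Site.tdist c.src c.tgt ≤ 1 := tdist_shift_le c.src c.dir
  have h10 : Site.tdist c.tgt c.src ≤ 1 := by rw [tdist_comm]; exact h01
  have h00 : Site.tdist c.src c.src ≤ 1 := by rw [tdist_self]; exact Nat.zero_le 1
  have h11 : Site.tdist c.tgt c.tgt ≤ 1 := by rw [tdist_self]; exact Nat.zero_le 1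
  rcases (mem_bondsOn_iff.mp hc) with hc | hc
  · rcases hx with hx | hx
    · exact mem_Omega_of_coarsen_near M₁ Rcol h hik hr hR' hc h00 hx
    · exact mem_Omega_of_coarsen_near M₁ Rcol h hik hr hR' hc h10 hx
  · rcases hx with hx | hx
    · exact mem_Omega_of_coarsen_near M₁ Rcol h hik hr hR' hc h01 hx
    · exact mem_Omega_of_coarsen_near M₁ Rcol h hik hr hR' hc h11 hx

/-- … hence in every `Ω_{i′}(h)`, `i′ ≤ i` — memo #48 (G1)'s proviso «the blocks under both end-points of a `bondsOn j Λ_j` bond lie in `Ω_{i+1}`» for all deeper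
levels at once. [cite: Balaban1985Variational, (1) p.277; Balaban1985UV3, (38)–(39) p.266] -/
theorem mem_Omega_of_le_of_mem_bondsOn {k : ℕ} (h : Hist P k) {i : ℕ} (hik : i + 1 ≤ k) (hr : i + 1 ≤ P.m + P.K)
    (hR : P.L + P.d * (P.L - 1) ≤ Rcol i) {c : PBond P (i + 1)} (hc : c ∈ bondsOn (i + 1) (Omega M₁ Rcol k h (i + 1)))
    {x : Site P 0} (hx : coarsen (i + 1) x = c.src ∨ coarsen (i + 1) x = c.tgt) {i' : ℕ} (hi' : i' ≤ i) : x ∈ Omega M₁ Rcol k h i' :=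
  Omega_antitone M₁ Rcol k h i' i hi' (Nat.le_of_succ_le hik) (mem_Omega_of_mem_bondsOn M₁ Rcol h hik hr hR hc hx)

/-- A bond ON a sub-ring `Ω_{i+1} ∖ X` (e.g. `Λ_{i+1} = lam42 Ω k (i+1)`) is a bond ON `Ω_{i+1}` (monotonicity of `bondsOn`), so §3 applies to the bonds read by the
constraint (3). [cite: Balaban1985Variational, (1) p.277] -/
theorem bondsOn_mono {j : ℕ} {X Y : Set (Site P 0)} (hXY : X ⊆ Y) : bondsOn j X ⊆ bondsOn (P := P) j Y :=
  fun _ hb => hb.elim (fun h1 => Or.inl (hXY h1)) (fun h2 => Or.inr (hXY h2))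

end Bonds

/-! ## §4 (G2-geo) At an outward straddler of `∂Ω_{i+1}` the block of a free corner lies in `Ω_i ∖ Ω_{i+1}` -/

section Straddlers

/-- The four corner sites of a plaquette are pairwise within `ℓ¹`-distance `2`. [folklore] -/
theorem tdist_corner_le_two {i : ℕ} (p : Plaq P i) :
    ∀ w w' : Site P i,
      (w = p.src ∨ w = p.src.shift p.μ ∨ w = p.src.shift p.ν ∨ w = (p.src.shift p.μ).shift p.ν) →
      (w' = p.src ∨ w' = p.src.shift p.μ ∨ w' = p.src.shift p.ν ∨ w' = (p.src.shift p.μ).shift p.ν) →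
      Site.tdist w w' ≤ 2 := by
  -- the six unordered distances
  have d01 : Site.tdist p.src (p.src.shift p.μ) ≤ 2 := (tdist_shift_le p.src p.μ).trans one_le_two
  have d02 : Site.tdist p.src (p.src.shift p.ν) ≤ 2 := (tdist_shift_le p.src p.ν).trans one_le_two
  have d13 : Site.tdist (p.src.shift p.μ) ((p.src.shift p.μ).shift p.ν) ≤ 2 := (tdist_shift_le _ p.ν).trans one_le_two
  have d03 : Site.tdist p.src ((p.src.shift p.μ).shift p.ν) ≤ 2 :=
    (tdist_triangle _ (p.src.shift p.μ) _).trans (Nat.add_le_add (tdist_shift_le p.src p.μ) (tdist_shift_le _ p.ν))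
  have d12 : Site.tdist (p.src.shift p.μ) (p.src.shift p.ν) ≤ 2 :=
    (tdist_triangle _ p.src _).trans
      (Nat.add_le_add (by rw [tdist_comm]; exact tdist_shift_le p.src p.μ) (tdist_shift_le p.src p.ν))
  have d23 : Site.tdist (p.src.shift p.ν) ((p.src.shift p.μ).shift p.ν) ≤ 2 := by
    -- the two unit shifts commute, so `p₃ = p₂ + e_μ` is one step from `p₂`
    have hne : p.μ ≠ p.ν := ne_of_lt p.hμν
    have hcomm : (p.src.shift p.μ).shift p.ν = (p.src.shift p.ν).shift p.μ := by
      funext κ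
      by_cases h1 : κ = p.ν
      · have h2 : κ ≠ p.μ := fun h => hne (h.symm.trans h1)
        simp [Site.shift, Function.update_apply, h1, hne.symm]
      · by_cases h2 : κ = p.μ
        · simp [Site.shift, Function.update_apply, h2, hne]
        · simp [Site.shift, Function.update_apply, h1, h2]
    rw [hcomm]
    exact (tdist_shift_le _ p.μ).trans one_le_two
  intro w w' hw hw'
  rcases hw with rfl | rfl | rfl | rfl <;> rcases hw' with rfl | rfl | rfl | rfl <;>
    first
    | (rw [tdist_self]; exact Nat.zero_le 2)
    | assumption
    | (rw [tdist_comm]; assumption)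

/-- Two fine corner points of a level-`i` plaquette have `i`-blocks within `ℓ¹`-distance `2` (standing range). [folklore] -/
theorem tdist_coarsen_le_two_of_mem_cornerSet {i : ℕ} (hr : i ≤ P.m + P.K) {p : Plaq P i} {a b : Site P 0} (ha : a ∈ cornerSet i p)
    (hb : b ∈ cornerSet i p) : Site.tdist (coarsen i a) (coarsen i b) ≤ 2 := by
  simp only [cornerSet, Set.mem_insert_iff, Set.mem_singleton_iff] at ha hb
  have hw : ∀ {c : Site P 0}, (c = toFine i p.src ∨ c = toFine i (p.src.shift p.μ) ∨ c = toFine i (p.src.shift p.ν) ∨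
      c = toFine i ((p.src.shift p.μ).shift p.ν)) →
      (coarsen i c = p.src ∨ coarsen i c = p.src.shift p.μ ∨ coarsen i c = p.src.shift p.ν ∨ coarsen i c = (p.src.shift p.μ).shift p.ν) := by
    intro c hc
    rcases hc with rfl | rfl | rfl | rfl <;> simp only [coarsen_toFine i hr] <;> simp
  exact tdist_corner_le_two p _ _ (hw ha) (hw hb)

variable (M₁ : ℕ) (Rcol : ℕ → ℕ)

/-- **★★ (G2-geo) THE BLOCK OF A FREE CORNER OF AN OUTWARD STRADDLER**: for a level-`(i+1)` plaquette with a corner point `a ∈ Ω_{i+1}(h)` and a corner point `b ∉ Ω_{i+1}(h)`,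
EVERY fine site of the `(i+1)`-block of `b` lies in `Ω_i(h) ∖ Ω_{i+1}(h)` (`∉` by block saturation, `∈` by the collar at two steps: row `2L + d(L−1) ≤ Rcol i`).
[cite: Balaban1985Variational, (7) p.278; Balaban1985UV3, (39) p.266] -/
theorem mem_sdiff_Omega_of_coarsen_eq_corner {k : ℕ} (h : Hist P k) {i : ℕ} (hik : i + 1 ≤ k) (hr : i + 1 ≤ P.m + P.K)
    (hR : 2 * P.L + P.d * (P.L - 1) ≤ Rcol i) {p : Plaq P (i + 1)} {a b : Site P 0} (ha : a ∈ cornerSet (i + 1) p) (hb : b ∈ cornerSet (i + 1) p)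
    (haΩ : a ∈ Omega M₁ Rcol k h (i + 1)) (hbΩ : b ∉ Omega M₁ Rcol k h (i + 1)) {x : Site P 0} (hx : coarsen (i + 1) x = coarsen (i + 1) b) :
    x ∈ Omega M₁ Rcol k h i \ Omega M₁ Rcol k h (i + 1) := by
  refine ⟨?_, fun hxΩ => hbΩ ((mem_Omega_iff_of_coarsen_eq M₁ Rcol h le_rfl hik hx).mp hxΩ)⟩
  obtain ⟨s, rfl⟩ : ∃ s : Site P (i + 1), a = toFine (i + 1) s := by
    simp only [cornerSet, Set.mem_insert_iff, Set.mem_singleton_iff] at ha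
    rcases ha with h1 | h1 | h1 | h1 <;> exact ⟨_, h1⟩
  have hd : Site.tdist (coarsen (i + 1) b) s ≤ 2 := by
    have h2 := tdist_coarsen_le_two_of_mem_cornerSet hr hb ha
    rwa [coarsen_toFine (i + 1) hr] at h2
  have hR' : P.L * 2 + P.d * (P.L - 1) ≤ Rcol i := by rwa [Nat.mul_comm P.L 2]
  exact mem_Omega_of_coarsen_near M₁ Rcol h hik hr hR' haΩ hd hx

/-- **★ (G2-geo), BOND FORM**: in the letter of `Averaging.local_dep` — a level-`i` bond `b′` whose base point's block is the free corner's site — the bond lies in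
`bondsOn i (Ω_i ∖ Ω_{i+1})`: the level-`i` bonds read by a one-step average at a free bond of an outward straddler are bonds ON the ring `Ω_i ∖ Ω_{i+1}`.
[cite: Balaban1985Variational, (7) p.278; Balaban1985Averaging, p.24] -/
theorem mem_bondsOn_sdiff_of_blockOf_eq_corner {k : ℕ} (h : Hist P k) {i : ℕ} (hik : i + 1 ≤ k) (hr : i + 1 ≤ P.m + P.K)
    (hR : 2 * P.L + P.d * (P.L - 1) ≤ Rcol i) {p : Plaq P (i + 1)} {a b : Site P 0} (ha : a ∈ cornerSet (i + 1) p) (hb : b ∈ cornerSet (i + 1) p)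
    (haΩ : a ∈ Omega M₁ Rcol k h (i + 1)) (hbΩ : b ∉ Omega M₁ Rcol k h (i + 1)) {b' : PBond P i} (hb' : blockOf b'.src = coarsen (i + 1) b) :
    b' ∈ bondsOn i (Omega M₁ Rcol k h i \ Omega M₁ Rcol k h (i + 1)) := by
  refine Or.inl (mem_sdiff_Omega_of_coarsen_eq_corner M₁ Rcol h hik hr hR ha hb haΩ hbΩ ?_)
  show blockOf (coarsen i (toFine i b'.src)) = coarsen (i + 1) b
  rw [coarsen_toFine i (Nat.le_of_succ_le hr), hb']

/-- The `lam42` wrapper: below the top level `n` of a (truncated) problem (`i < n`), `lam42 Ω(h) n i = Ω_i ∖ Ω_{i+1}`, so the bond of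
`mem_bondsOn_sdiff_of_blockOf_eq_corner` is ON the read region `Λ′_i`. [cite: Balaban1985Variational, (7) p.278; Balaban1985UV3, (42) p.266] -/
theorem mem_bondsOn_lam42_of_blockOf_eq_corner {k : ℕ} (h : Hist P k) {i n : ℕ} (hin : i < n) (hik : i + 1 ≤ k) (hr : i + 1 ≤ P.m + P.K)
    (hR : 2 * P.L + P.d * (P.L - 1) ≤ Rcol i) {p : Plaq P (i + 1)} {a b : Site P 0} (ha : a ∈ cornerSet (i + 1) p) (hb : b ∈ cornerSet (i + 1) p)
    (haΩ : a ∈ Omega M₁ Rcol k h (i + 1)) (hbΩ : b ∉ Omega M₁ Rcol k h (i + 1)) {b' : PBond P i} (hb' : blockOf b'.src = coarsen (i + 1) b) :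
    b' ∈ bondsOn i (lam42 (Omega M₁ Rcol k h) n i) := by
  rw [lam42_of_lt hin]
  exact mem_bondsOn_sdiff_of_blockOf_eq_corner M₁ Rcol h hik hr hR ha hb haΩ hbΩ hb'

end Straddlers

/-! ## §5 At the T³ record: both collar rows are served by the record size `7L + 3 ≤ M₁` -/

section T3

open Literature.MathematicalPhysics.QuantumFieldTheory.Balaban1983to89.T3ContinuumYM3Torus
open Literature.MathematicalPhysics.QuantumFieldTheory.Balaban1985CMP102.Setting
open Summit.QuantumFields.Balaban3D.Proofs.Primitives (AlphaConsts)
open Summit.QuantumFields.YangMills.Theorems.Reg68LevelsOfFineRegular (six_mul_M₁_le_rcolOf)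

variable (F : T3Family) (𝔠 : AlphaConsts F.L (suGroupModel 2).N) (γ : ℝ) (hγ : 0 < γ) (hγ1 : γ ≤ (min 𝔠.gamma0 1) ^ 2) (K : ℕ)

/-- **THE COLLAR ROWS AT THE RECORD**: `2L + 3(L−1) ≤ Rcol_i` and `L + 3(L−1) ≤ Rcol_i` for every `i ≤ K`, from `6·M₁ ≤ Rcol_i`
(`Reg68LevelsOfFineRegular.six_mul_M₁_le_rcolOf`) and the record size `7L + 3 ≤ M₁`. [cite: Balaban1985UV3, (7) p.257 and (39) p.266] -/
theorem collar_rows_T3 (hM₁ : 7 * F.L + 3 ≤ 𝔠.M₁) (i : ℕ) (hi : i ≤ K) :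
    2 * (F.P K).L + (F.P K).d * ((F.P K).L - 1) ≤ rcolOf (T3Scales F γ hγ (hγ1.trans (sq_min_one_le _ 𝔠.gamma0_pos)) K) 𝔠.lane.carrier i ∧
      (F.P K).L + (F.P K).d * ((F.P K).L - 1) ≤ rcolOf (T3Scales F γ hγ (hγ1.trans (sq_min_one_le _ 𝔠.gamma0_pos)) K) 𝔠.lane.carrier i := by
  have h6 := six_mul_M₁_le_rcolOf F 𝔠 γ hγ hγ1 K i hi
  have hL : (F.P K).L = F.L := rfl
  have hd : (F.P K).d = 3 := rfl
  rw [hL, hd]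
  constructor <;> omega

variable {F 𝔠 γ hγ hγ1 K}

/-- **(G1-geo) AT THE RECORD**: for `k ≤ K`, a history `h : Hist (F.P K) k`, `i + 1 ≤ k` and a level-`(i+1)` bond ON `Ω_{i+1}(h)`, every fine site of the blocks of both
end-points lies in `Ω_{i′}(h)` for every `i′ ≤ i` — collar row discharged by `7L + 3 ≤ M₁`. [cite: Balaban1985Variational, (1) p.277; Balaban1985UV3, (39) p.266] -/
theorem mem_Omega_of_le_of_mem_bondsOn_T3 (hM₁ : 7 * F.L + 3 ≤ 𝔠.M₁) {k : ℕ} (hk : k ≤ K) (h : Hist (F.P K) k) {i : ℕ} (hik : i + 1 ≤ k)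
    {c : PBond (F.P K) (i + 1)}
    (hc : c ∈ bondsOn (i + 1) (Omega 𝔠.lane.carrier.M₁ (rcolOf (T3Scales F γ hγ (hγ1.trans (sq_min_one_le _ 𝔠.gamma0_pos)) K) 𝔠.lane.carrier) k h (i + 1)))
    {x : Site (F.P K) 0} (hx : coarsen (i + 1) x = c.src ∨ coarsen (i + 1) x = c.tgt) {i' : ℕ} (hi' : i' ≤ i) :
    x ∈ Omega 𝔠.lane.carrier.M₁ (rcolOf (T3Scales F γ hγ (hγ1.trans (sq_min_one_le _ 𝔠.gamma0_pos)) K) 𝔠.lane.carrier) k h i' :=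
  mem_Omega_of_le_of_mem_bondsOn _ _ h hik (hik.trans (AlphaInputsT3AC.le_standing_of_le (F := F) hk))
    (collar_rows_T3 F 𝔠 γ hγ hγ1 K hM₁ i (by omega)).2 hc hx hi'

/-- **(G2-geo) AT THE RECORD, `lam42` BOND FORM**: below the top level `n` (`i < n`), at an outward straddler of `∂Ω_{i+1}(h)` (corner points `a ∈ Ω_{i+1}(h)`,
`b ∉ Ω_{i+1}(h)`), every level-`i` bond whose base point's block is `b`'s site lies in `bondsOn i (lam42 Ω(h) n i)` — collar row discharged by `7L + 3 ≤ M₁`.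
[cite: Balaban1985Variational, (7) p.278; Balaban1985UV3, (39) p.266] -/
theorem mem_bondsOn_lam42_of_blockOf_eq_corner_T3 (hM₁ : 7 * F.L + 3 ≤ 𝔠.M₁) {k : ℕ} (hk : k ≤ K) (h : Hist (F.P K) k) {i n : ℕ} (hin : i < n)
    (hik : i + 1 ≤ k) {p : Plaq (F.P K) (i + 1)} {a b : Site (F.P K) 0} (ha : a ∈ cornerSet (i + 1) p) (hb : b ∈ cornerSet (i + 1) p)
    (haΩ : a ∈ Omega 𝔠.lane.carrier.M₁ (rcolOf (T3Scales F γ hγ (hγ1.trans (sq_min_one_le _ 𝔠.gamma0_pos)) K) 𝔠.lane.carrier) k h (i + 1))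
    (hbΩ : b ∉ Omega 𝔠.lane.carrier.M₁ (rcolOf (T3Scales F γ hγ (hγ1.trans (sq_min_one_le _ 𝔠.gamma0_pos)) K) 𝔠.lane.carrier) k h (i + 1))
    {b' : PBond (F.P K) i} (hb' : blockOf b'.src = coarsen (i + 1) b) :
    b' ∈ bondsOn i (lam42 (Omega 𝔠.lane.carrier.M₁ (rcolOf (T3Scales F γ hγ (hγ1.trans (sq_min_one_le _ 𝔠.gamma0_pos)) K) 𝔠.lane.carrier) k h) n i) :=
  mem_bondsOn_lam42_of_blockOf_eq_corner _ _ h hin hik (hik.trans (AlphaInputsT3AC.le_standing_of_le (F := F) hk))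
    (collar_rows_T3 F 𝔠 γ hγ hγ1 K hM₁ i (by omega)).1 ha hb haΩ hbΩ hb'

end T3

end Summit.QuantumFields.YangMills.Theorems.OmegaCollarGeometry
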